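import Mathlib.Analysis.Normed.Module.Connected
import Mathlib.Analysis.Convex.PathConnected
import Mathlib.LinearAlgebra.Complex.FiniteDimensional
import Summits.SmoothPoincare4.SmoothPoincare4.Theorems.DottedCircleRasmussenDcrGapHelperFriendsCarrierExterior
import Summits.SmoothPoincare4.SmoothPoincare4.Theses.DottedCircleRasmussen

/-!
# Helper `helper_friendsPi1_G1` (`ℝ⁴ ∖ D_k` is simply connected) — part 1: the open cover
(sub-goal G1 of stub `stub_friendsPi1`, line `mk_friends`, crux `DcrGap`;
item stmt-SmoothPoincare4-16128, route route-SmoothPoincare4-DottedCircleRasmussen)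

`D_k = MMSW.modelHandlebody k = {guard ∧ G_k ≤ 1} ⊂ ℝ⁴ = ℂ_z × ℂ_w` is the model dotted handlebody,
`G_k = |z|²/(40(k+1))² + Σ_j 1/|z - c_j|² + |w|²`.  Two elementary features of `G_k` drive the whole
proof that `ℝ⁴ ∖ D_k` is simply connected (part 2, file `…HelperFriendsPi1G1.lean`):

* `not_mem_mono` — the complement is closed UPWARDS in `|w|` over each `z` (the guard only sees `z`,
  and `G_k` is increasing in `|w|²`); `not_mem_of_one_lt_norm_w` — `{|w| > 1} ⊆ ℝ⁴ ∖ D_k`;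
* `ofZW_zFar_not_mem` — over the far point `z_far = 50(k+1)` the whole fibre `{z_far} × ℂ` misses
  `D_k` (`|z_far|²/(40(k+1))² = 25/16 > 1`).

With the base point `x_far = (z_far, 3)` the cover used in part 2 is
`U = (ℝ⁴ ∖ D_k) ∩ {w ≠ 0}` and `V = {(z, w) | (z, 0) ∉ D_k} ∪ {Re w > 2}` (both inside `ℝ⁴ ∖ D_k`,
`V` containing every point of the complement with `w = 0`).  This file proves the point-set half of
van Kampen's hypotheses, packaged as the registered helper `helper_friendsPi1_G1_cover`:
`U`, `V` are open, `U ∪ V = ℝ⁴ ∖ D_k`, and `U`, `V`, `U ∩ V` are path connected — every point is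
joined to `x_far` by at most three explicit moves: a `w`-segment or a path in a punctured fibre
`{z} × (ℂ ∖ 0)` (`isPathConnected_compl_singleton_of_one_lt_rank`), a `z`-segment at a height
`|w| > 1`, and a path in the free fibre over `z_far`.

Everything is proved; no definitions, no notations, no named facts, no `sorry`.

## References

* A. Hatcher, *Algebraic Topology* (2002), §1.2 (van Kampen) [HatcherAT2002].
* R. Kirby, *The Topology of 4-Manifolds*, LNM 1374 (1989), Ch. I §2 (dotted circles) [Kirby1989].
-/

-- the prescribed namespace `Summit.<P>.<Sub>.…` duplicates `SmoothPoincare4` (P = Sub)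
set_option linter.dupNamespace false
set_option linter.style.longLine false

noncomputable section

open scoped Topology
open Function Set
open Literature.Topology.FourManifolds Literature.Topology.FourManifolds.MMSW
open Literature.AlgebraicTopology.Homotopy.HopfFibration (zC wC ofZW zC_ofZW wC_ofZW ofZW_zC_wC
  continuous_zC continuous_wC continuous_ofZW)

namespace Summit.SmoothPoincare4.SmoothPoincare4.Theorems.DcrGap.MkFriends

variable {k : ℕ}

/-! ## Model facts: `ℝ⁴ ∖ D_k` is closed upwards in `|w|`, and free over `z_far` -/

/-- The planar and fibre terms bound `G_k` from below: `|z|²/(40(k+1))² + |w|² ≤ G_k`. [folklore] -/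
theorem normSq_le_levelFun (k : ℕ) (x : EuclideanSpace ℝ (Fin 4)) :
    Complex.normSq (zC x) / (40 * ((k : ℝ) + 1)) ^ 2 + Complex.normSq (wC x) ≤ levelFun k x := by
  rw [levelFun_eq]
  have : 0 ≤ ∑ j : Fin k, 1 / Complex.normSq (zC x - holeCentre k j) :=
    Finset.sum_nonneg fun j _ => one_div_nonneg.2 (Complex.normSq_nonneg _)
  linarith

/-- A point with `G_k > 1` is outside `D_k`. [folklore] -/
theorem not_mem_of_one_lt_levelFun {x : EuclideanSpace ℝ (Fin 4)} (h : 1 < levelFun k x) :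
    x ∉ modelHandlebody k :=
  fun hx => absurd hx.2 (not_le.2 h)

/-- A point with `|w| > 1` is outside `D_k`. [folklore] -/
theorem not_mem_of_one_lt_norm_w {x : EuclideanSpace ℝ (Fin 4)} (h : 1 < ‖wC x‖) :
    x ∉ modelHandlebody k := by
  refine not_mem_of_one_lt_levelFun (lt_of_lt_of_le ?_ (normSq_le_levelFun k x))
  have h1 : 1 < Complex.normSq (wC x) := by
    rw [Complex.normSq_eq_norm_sq]; nlinarith [norm_nonneg (wC x)]
  have h2 : 0 ≤ Complex.normSq (zC x) / (40 * ((k : ℝ) + 1)) ^ 2 :=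
    div_nonneg (Complex.normSq_nonneg _) (by positivity)
  linarith

/-- Over `z_far = 50(k+1)` the whole fibre is outside `D_k` (`|z_far|²/(40(k+1))² = 25/16 > 1`).
[folklore] -/
theorem ofZW_zFar_not_mem (k : ℕ) (w : ℂ) :
    ofZW ((50 * ((k : ℝ) + 1) : ℝ) : ℂ) w ∉ modelHandlebody k := by
  refine not_mem_of_one_lt_levelFun (lt_of_lt_of_le ?_ (normSq_le_levelFun k _))
  rw [zC_ofZW, wC_ofZW]
  have hk : (0 : ℝ) < (k : ℝ) + 1 := by positivity
  have h1 : Complex.normSq ((50 * ((k : ℝ) + 1) : ℝ) : ℂ) / (40 * ((k : ℝ) + 1)) ^ 2 =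
      25 / 16 := by
    rw [Complex.normSq_ofReal]
    field_simp
    ring
  have h2 := Complex.normSq_nonneg w
  linarith

/-- **`ℝ⁴ ∖ D_k` is closed upwards in `|w|` over each `z`.** [folklore] -/
theorem not_mem_mono {x y : EuclideanSpace ℝ (Fin 4)} (hx : x ∉ modelHandlebody k)
    (hz : zC y = zC x) (hw : ‖wC x‖ ≤ ‖wC y‖) : y ∉ modelHandlebody k := by
  intro hy
  apply hx
  refine ⟨fun j => ?_, ?_⟩
  · have := hy.1 j
    rw [holeTerm_eq_normSq] at this ⊢
    rwa [hz] at this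
  · have h := hy.2
    rw [levelFun_eq] at h ⊢
    rw [hz] at h
    have : Complex.normSq (wC x) ≤ Complex.normSq (wC y) := by
      rw [Complex.normSq_eq_norm_sq, Complex.normSq_eq_norm_sq]
      exact pow_le_pow_left₀ (norm_nonneg _) hw 2
    linarith

/-- If `(z, 0) ∉ D_k` then the whole fibre over `z` is outside `D_k`. [folklore] -/
theorem ofZW_not_mem_of_base {z : ℂ} (h : ofZW z 0 ∉ modelHandlebody k) (w : ℂ) :
    ofZW z w ∉ modelHandlebody k :=
  not_mem_mono h (by simp) (by simp)

/-- `Re w > 2` forces `|w| > 1`. [folklore] -/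
theorem one_lt_norm_of_two_lt_re {v : ℂ} (h : 2 < v.re) : 1 < ‖v‖ := by
  have := Complex.re_le_norm v
  linarith

/-- A convex combination of a number `> 2` and `3` is `> 2`. [folklore] -/
theorem two_lt_convex {a b r : ℝ} (ha : 0 ≤ a) (hb : 0 ≤ b) (hab : a + b = 1) (hr : 2 < r) :
    2 < a * r + b * 3 := by
  rcases hb.eq_or_lt with rfl | hb'
  · rw [add_zero] at hab; subst hab; linarith
  · nlinarith [mul_nonneg ha (sub_nonneg.2 hr.le)]

/-! ## The two open pieces `U`, `V` of `ℝ⁴ ∖ D_k` -/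

/-- `U ⊆ ℝ⁴ ∖ D_k`. [folklore] -/
theorem USet_subset :
    {x : EuclideanSpace ℝ (Fin 4) | x ∉ modelHandlebody k ∧ wC x ≠ 0} ⊆ (modelHandlebody k)ᶜ :=
  fun _ hx => hx.1

/-- `V ⊆ ℝ⁴ ∖ D_k`. [folklore] -/
theorem VSet_subset :
    {x : EuclideanSpace ℝ (Fin 4) | ofZW (zC x) 0 ∉ modelHandlebody k ∨ 2 < (wC x).re} ⊆
      (modelHandlebody k)ᶜ := by
  rintro x (hx | hx)
  · rw [mem_compl_iff, ← ofZW_zC_wC x]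
    exact ofZW_not_mem_of_base hx _
  · exact not_mem_of_one_lt_norm_w (one_lt_norm_of_two_lt_re hx)

/-- `ℝ⁴ ∖ D_k` is open. [folklore] -/
theorem isOpen_compl_modelHandlebody (k : ℕ) : IsOpen (modelHandlebody k)ᶜ :=
  (isClosed_modelHandlebody k).isOpen_compl

/-- `U` is open. [folklore] -/
theorem isOpen_USet : IsOpen {x : EuclideanSpace ℝ (Fin 4) | x ∉ modelHandlebody k ∧ wC x ≠ 0} :=
  (isOpen_compl_modelHandlebody k).inter (isOpen_compl_singleton.preimage continuous_wC)

/-- `x ↦ (z(x), 0)` is continuous. [folklore] -/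
theorem continuous_ofZW_base : Continuous fun x : EuclideanSpace ℝ (Fin 4) => ofZW (zC x) 0 :=
  continuous_ofZW.comp (continuous_zC.prodMk continuous_const)

/-- `V` is open. [folklore] -/
theorem isOpen_VSet :
    IsOpen {x : EuclideanSpace ℝ (Fin 4) | ofZW (zC x) 0 ∉ modelHandlebody k ∨ 2 < (wC x).re} :=
  ((isOpen_compl_modelHandlebody k).preimage continuous_ofZW_base).union
    (isOpen_lt continuous_const (Complex.continuous_re.comp continuous_wC))

/-- The base point `x_far = (z_far, 3)` lies in `U`. [folklore] -/
theorem xFar_mem_USet :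
    ofZW ((50 * ((k : ℝ) + 1) : ℝ) : ℂ) 3 ∈ {x : EuclideanSpace ℝ (Fin 4) | x ∉ modelHandlebody k ∧ wC x ≠ 0} :=
  ⟨ofZW_zFar_not_mem k 3, by simp⟩

/-- The base point `x_far = (z_far, 3)` lies in `V`. [folklore] -/
theorem xFar_mem_VSet : ofZW ((50 * ((k : ℝ) + 1) : ℝ) : ℂ) 3 ∈
    {x : EuclideanSpace ℝ (Fin 4) | ofZW (zC x) 0 ∉ modelHandlebody k ∨ 2 < (wC x).re} :=
  Or.inr (by norm_num)

/-- **`U ∪ V = ℝ⁴ ∖ D_k`**: a point of the complement with `w = 0` lies in `V`. [folklore] -/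
theorem USet_union_VSet :
    {x : EuclideanSpace ℝ (Fin 4) | x ∉ modelHandlebody k ∧ wC x ≠ 0} ∪
      {x : EuclideanSpace ℝ (Fin 4) | ofZW (zC x) 0 ∉ modelHandlebody k ∨ 2 < (wC x).re} =
      (modelHandlebody k)ᶜ := by
  refine Subset.antisymm (union_subset USet_subset VSet_subset) fun x hx => ?_
  by_cases hw : wC x = 0
  · refine Or.inr (Or.inl ?_)
    rw [← hw, ofZW_zC_wC]
    exact hx
  · exact Or.inl ⟨hx, hw⟩

/-! ## Joining points fibrewise -/

/-- `w ↦ (z, w)` is continuous. [folklore] -/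
theorem continuous_ofZW_right (z : ℂ) : Continuous fun w : ℂ => ofZW z w :=
  continuous_ofZW.comp (continuous_const.prodMk continuous_id)

/-- `z ↦ (z, w)` is continuous. [folklore] -/
theorem continuous_ofZW_left (w : ℂ) : Continuous fun z : ℂ => ofZW z w :=
  continuous_ofZW.comp (continuous_id.prodMk continuous_const)

/-- A `w`-segment over a fixed `z` whose points stay in `F` joins its ends in `F`. [folklore] -/
theorem joinedIn_wSeg {F : Set (EuclideanSpace ℝ (Fin 4))} {z w w' : ℂ}
    (h : ∀ a b : ℝ, 0 ≤ a → 0 ≤ b → a + b = 1 → ofZW z (a • w + b • w') ∈ F) :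
    JoinedIn F (ofZW z w) (ofZW z w') := by
  have hs : segment ℝ w w' ⊆ (fun v : ℂ => ofZW z v) ⁻¹' F := (segment_subset_iff ℝ).2 h
  exact ((JoinedIn.of_segment_subset hs).map (continuous_ofZW_right z)).mono
    (image_preimage_subset _ _)

/-- A `z`-segment at a fixed `w` whose points stay in `F` joins its ends in `F`. [folklore] -/
theorem joinedIn_zSeg {F : Set (EuclideanSpace ℝ (Fin 4))} {z z' w : ℂ}
    (h : ∀ a b : ℝ, 0 ≤ a → 0 ≤ b → a + b = 1 → ofZW (a • z + b • z') w ∈ F) :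
    JoinedIn F (ofZW z w) (ofZW z' w) := by
  have hs : segment ℝ z z' ⊆ (fun v : ℂ => ofZW v w) ⁻¹' F := (segment_subset_iff ℝ).2 h
  exact ((JoinedIn.of_segment_subset hs).map (continuous_ofZW_left w)).mono
    (image_preimage_subset _ _)

/-- Two points of a punctured fibre `{z} × (ℂ ∖ 0) ⊆ F` are joined in `F` (`ℂ ∖ 0` is path
connected). [folklore] -/
theorem joinedIn_wPunctured {F : Set (EuclideanSpace ℝ (Fin 4))} {z w w' : ℂ} (hw : w ≠ 0)
    (hw' : w' ≠ 0) (h : ∀ v : ℂ, v ≠ 0 → ofZW z v ∈ F) : JoinedIn F (ofZW z w) (ofZW z w') := by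
  have hpc : IsPathConnected ({(0 : ℂ)}ᶜ : Set ℂ) :=
    isPathConnected_compl_singleton_of_one_lt_rank
      (by rw [Complex.rank_real_complex]; exact Cardinal.one_lt_two) 0
  refine ((hpc.joinedIn w hw w' hw').map (continuous_ofZW_right z)).mono ?_
  rintro _ ⟨v, hv, rfl⟩
  exact h v hv

/-- The `z`-segment at height `w = 3` from `(z, 3)` to the base point lies in `U ∩ V`. [folklore] -/
theorem joinedIn_top (z : ℂ) :
    JoinedIn ({x : EuclideanSpace ℝ (Fin 4) | x ∉ modelHandlebody k ∧ wC x ≠ 0} ∩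
      {x : EuclideanSpace ℝ (Fin 4) | ofZW (zC x) 0 ∉ modelHandlebody k ∨ 2 < (wC x).re})
      (ofZW z 3) (ofZW ((50 * ((k : ℝ) + 1) : ℝ) : ℂ) 3) := by
  refine joinedIn_zSeg fun a b _ _ _ => ⟨⟨not_mem_of_one_lt_norm_w ?_, ?_⟩, Or.inr ?_⟩
  · simp
  · simp
  · norm_num

/-! ## `U`, `V` and `U ∩ V` are path connected -/

/-- **`V` is path connected**: push `w` linearly to `3`, then `z` to `z_far`. [folklore] -/
theorem isPathConnected_VSet :
    IsPathConnected {x : EuclideanSpace ℝ (Fin 4) | ofZW (zC x) 0 ∉ modelHandlebody k ∨ 2 < (wC x).re} := by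
  refine ⟨ofZW ((50 * ((k : ℝ) + 1) : ℝ) : ℂ) 3, xFar_mem_VSet, fun y hy => JoinedIn.symm ?_⟩
  rw [← ofZW_zC_wC y]
  refine JoinedIn.trans ?_ ((joinedIn_top (zC y)).mono inter_subset_right)
  refine joinedIn_wSeg fun a b ha hb hab => ?_
  rcases hy with hy | hy
  · exact Or.inl (by simpa using hy)
  · refine Or.inr ?_
    simp only [wC_ofZW, Complex.add_re, Complex.smul_re, smul_eq_mul, Complex.re_ofNat]
    exact two_lt_convex ha hb hab hy

/-- **`U ∩ V` is path connected**: over a free base point go round the punctured fibre to `w = 3`,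
in `{Re w > 2}` push `w` linearly to `3`; then `z` to `z_far`. [folklore] -/
theorem isPathConnected_USet_inter_VSet :
    IsPathConnected ({x : EuclideanSpace ℝ (Fin 4) | x ∉ modelHandlebody k ∧ wC x ≠ 0} ∩
      {x : EuclideanSpace ℝ (Fin 4) | ofZW (zC x) 0 ∉ modelHandlebody k ∨ 2 < (wC x).re}) := by
  refine ⟨ofZW ((50 * ((k : ℝ) + 1) : ℝ) : ℂ) 3, ⟨xFar_mem_USet, xFar_mem_VSet⟩, fun y hy =>
    JoinedIn.symm ?_⟩
  obtain ⟨⟨hyD, hyw⟩, hy | hy⟩ := hy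
  · rw [← ofZW_zC_wC y]
    refine JoinedIn.trans ?_ (joinedIn_top (zC y))
    refine joinedIn_wPunctured hyw (by norm_num) fun v hv => ⟨⟨ofZW_not_mem_of_base hy v, ?_⟩, ?_⟩
    · simpa using hv
    · exact Or.inl (by simpa using hy)
  · rw [← ofZW_zC_wC y]
    refine JoinedIn.trans ?_ (joinedIn_top (zC y))
    refine joinedIn_wSeg fun a b ha hb hab => ?_
    have hre : 2 < (a • wC y + b • (3 : ℂ)).re := by
      simp only [Complex.add_re, Complex.smul_re, smul_eq_mul, Complex.re_ofNat]
      exact two_lt_convex ha hb hab hy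
    refine ⟨⟨not_mem_of_one_lt_norm_w ?_, ?_⟩, Or.inr ?_⟩
    · simpa using one_lt_norm_of_two_lt_re hre
    · intro h0
      rw [wC_ofZW] at h0
      rw [h0] at hre
      norm_num at hre
    · simpa using hre

/-- **`U` is path connected**: push `w` radially out to norm `|w| + 3`, move `z` to `z_far` at that
height, then go round the punctured free fibre over `z_far` to `w = 3`. [folklore] -/
theorem isPathConnected_USet :
    IsPathConnected {x : EuclideanSpace ℝ (Fin 4) | x ∉ modelHandlebody k ∧ wC x ≠ 0} := by
  refine ⟨ofZW ((50 * ((k : ℝ) + 1) : ℝ) : ℂ) 3, xFar_mem_USet, fun y hy => JoinedIn.symm ?_⟩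
  obtain ⟨hyD, hyw⟩ := hy
  rw [← ofZW_zC_wC y]
  set z := zC y with hz
  set w := wC y with hw
  have hw0 : 0 < ‖w‖ := norm_pos_iff.2 hyw
  -- radial push to `w₁ = w + (3/‖w‖) • w`, of norm `‖w‖ + 3`
  set w₁ : ℂ := w + (3 / ‖w‖) • w with hw₁
  have hnorm₁ : ‖w₁‖ = ‖w‖ + 3 := by
    have : w₁ = ((‖w‖ + 3) / ‖w‖) • w := by
      rw [hw₁, add_div, div_self hw0.ne', add_smul, one_smul]
    rw [this, norm_smul, Real.norm_eq_abs, abs_of_pos (by positivity), div_mul_cancel₀ _ hw0.ne']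
  have h1 : JoinedIn {x : EuclideanSpace ℝ (Fin 4) | x ∉ modelHandlebody k ∧ wC x ≠ 0} (ofZW z w)
      (ofZW z w₁) := by
    refine joinedIn_wSeg fun a b ha hb hab => ?_
    obtain rfl : a = 1 - b := eq_sub_of_add_eq hab
    have hpt : (1 - b) • w + b • w₁ = (1 + 3 * b / ‖w‖) • w := by
      rw [hw₁]; module
    have hc : 0 < 1 + 3 * b / ‖w‖ := by positivity
    have hn : ‖(1 + 3 * b / ‖w‖) • w‖ = ‖w‖ + 3 * b := by
      rw [norm_smul, Real.norm_eq_abs, abs_of_pos hc]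
      field_simp
    rw [hpt]
    refine ⟨not_mem_mono hyD (by simp [hz]) ?_, ?_⟩
    · rw [wC_ofZW, hn, ← hw]
      linarith
    · rw [wC_ofZW]; exact smul_ne_zero hc.ne' hyw
  -- move `z` to `z_far` at height `‖w‖ + 3 > 1`
  have h2 : JoinedIn {x : EuclideanSpace ℝ (Fin 4) | x ∉ modelHandlebody k ∧ wC x ≠ 0} (ofZW z w₁)
      (ofZW ((50 * ((k : ℝ) + 1) : ℝ) : ℂ) w₁) := by
    refine joinedIn_zSeg fun a b _ _ _ => ⟨not_mem_of_one_lt_norm_w ?_, ?_⟩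
    · rw [wC_ofZW, hnorm₁]; linarith
    · rw [wC_ofZW, ← norm_pos_iff, hnorm₁]; positivity
  -- go round the punctured (free) fibre over `z_far`
  have h3 : JoinedIn {x : EuclideanSpace ℝ (Fin 4) | x ∉ modelHandlebody k ∧ wC x ≠ 0}
      (ofZW ((50 * ((k : ℝ) + 1) : ℝ) : ℂ) w₁) (ofZW ((50 * ((k : ℝ) + 1) : ℝ) : ℂ) 3) :=
    joinedIn_wPunctured (by rw [← norm_pos_iff, hnorm₁]; positivity) (by norm_num)
      fun v hv => ⟨ofZW_zFar_not_mem k v, by simpa using hv⟩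
  exact (h1.trans h2).trans h3

/-- **The open cover of `ℝ⁴ ∖ D_k`** (registered helper `helper_friendsPi1_G1_cover`, part 1 of
sub-goal G1 of `stub_friendsPi1`): with `U = (ℝ⁴ ∖ D_k) ∩ {w ≠ 0}` and
`V = {(z, w) | (z, 0) ∉ D_k} ∪ {Re w > 2}`, the sets `U`, `V` are open, `U ∪ V = ℝ⁴ ∖ D_k`, and `U`,
`V`, `U ∩ V` are path connected. [folklore] -/
theorem helper_friendsPi1_G1_cover : ∀ (k : ℕ), IsOpen {x : EuclideanSpace ℝ (Fin 4) | x ∉ Literature.Topology.FourManifolds.MMSW.modelHandlebody k ∧ Literature.AlgebraicTopology.Homotopy.HopfFibration.wC x ≠ 0} ∧ IsOpen {x : EuclideanSpace ℝ (Fin 4) | Literature.AlgebraicTopology.Homotopy.HopfFibration.ofZW (Literature.AlgebraicTopology.Homotopy.HopfFibration.zC x) 0 ∉ Literature.Topology.FourManifolds.MMSW.modelHandlebody k ∨ 2 < (Literature.AlgebraicTopology.Homotopy.HopfFibration.wC x).re} ∧ {x : EuclideanSpace ℝ (Fin 4) | x ∉ Literature.Topology.FourManifolds.MMSW.modelHandlebody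 k ∧ Literature.AlgebraicTopology.Homotopy.HopfFibration.wC x ≠ 0} ∪ {x : EuclideanSpace ℝ (Fin 4) | Literature.AlgebraicTopology.Homotopy.HopfFibration.ofZW (Literature.AlgebraicTopology.Homotopy.HopfFibration.zC x) 0 ∉ Literature.Topology.FourManifolds.MMSW.modelHandlebody k ∨ 2 < (Literature.AlgebraicTopology.Homotopy.HopfFibration.wC x).re} = (Literature.Topology.FourManifolds.MMSW.modelHandlebody k)ᶜ ∧ IsPathConnected {x : EuclideanSpace ℝ (Fin 4) | x ∉ Literature.Topology.FourManifolds.MMSW.modelHandlebody k ∧ Literature.AlgebraicTopology.Homotopy.HopfFibration.wC x ≠ 0} ∧ IsPathConnected {x : EuclideanSpace ℝ (Fin 4) | Literature.AlgebraicTopology.Homotopy.HopfFibration.ofZW (Literature.AlgebraicTopology.Homotopy.HopfFibration.zC x) 0 ∉ Literature.Topology.FourManifolds.MMSW.modelHandlebody k ∨ 2 < (Literature.AlgebraicTopology.Homotopy.HopfFibration.wC x).re} ∧ IsPathConnected ({x : EuclideanSpace ℝ (Fin 4) | x ∉ Literature.Topology.FourManifolds.MMSW.modelHandlebody k ∧ Literature.AlgebraicTopology.Homotopy.HopfFibration.wC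 x ≠ 0} ∩ {x : EuclideanSpace ℝ (Fin 4) | Literature.AlgebraicTopology.Homotopy.HopfFibration.ofZW (Literature.AlgebraicTopology.Homotopy.HopfFibration.zC x) 0 ∉ Literature.Topology.FourManifolds.MMSW.modelHandlebody k ∨ 2 < (Literature.AlgebraicTopology.Homotopy.HopfFibration.wC x).re}) :=
  fun _ => ⟨isOpen_USet, isOpen_VSet, USet_union_VSet, isPathConnected_USet, isPathConnected_VSet,
    isPathConnected_USet_inter_VSet⟩

end Summit.SmoothPoincare4.SmoothPoincare4.Theorems.DcrGap.MkFriends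

end
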